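import Summits.CriticalPhenomena.Ising3D.Control2DRhoCoordinate
import Mathlib.MeasureTheory.Integral.IntervalIntegral.Basic
import Mathlib.MeasureTheory.Integral.IntervalIntegral.IntegrationByParts
import Mathlib.Analysis.SpecialFunctions.Pow.Deriv
import Mathlib.Analysis.SpecialFunctions.Pow.Continuity
import Mathlib.Analysis.SpecialFunctions.Log.Basic
import Mathlib.Analysis.SpecialFunctions.Sqrt
import Mathlib.Tactic.Linarith
import Mathlib.Tactic.Positivity
import Mathlib.Tactic.FieldSimp
import Mathlib.Tactic.Ring
import Mathlib.Tactic.NormNum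
import HarnessLib

/-!
# The upper half of the `ρ`-coordinate bound: `k_{2h}(z) ≤ e(1+√h)(4ρ)^h/(1-ρ)²` by an Euler-type integral comparison
(cell `pub-ising3x`, seat controls-1 gen 47; PAPER §6.2 / Appendix E — CONTROL-ONLY; sequel to `Control2DRhoCoordinate`)

HONEST FRAMING: lottery ticket; floor = tightest certified 3D Ising CFT bounds; no exact-solution
claim without a proof. CONTROL-ONLY (`d = 2`, global `sl(2) × sl(2)` blocks, `Δ_σ = s` an INPUT, axiom set `A2D′`); PURE BLOCK
ANALYSIS — no datum, no certificate, functional or number of the record, no new hypothesis, definition or named fact.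

WHAT THIS FILE ADDS. `Control2DRhoCoordinate` proved the LOWER half `(4ρ)^h ≤ k_{2h}(z)` at `z = 4ρ/(1+ρ)²` by Cauchy–Schwarz; the sharp
rate `ρ(x₀)^E` needs an UPPER bound of the same exponential order with a factor at most polynomial in `h`. Proved here WITHOUT the
`ρ`-expansion (Hogervorst–Rychkov's `(4ρ)^h ₂F₁(½,h;h+½;ρ²) ≤ (4ρ)^h(1-ρ²)^{-1/2}` is NOT proved; the loss against it is polynomial):
* `0 ≤ h ≤ 1`: the landed envelope `k_{2h}(z) ≤ (z/(1-z))^h = (4ρ)^h(1-ρ)^{-2h} ≤ (4ρ)^h(1-ρ)^{-2}` (`chiralBlock_le_of_le_one`);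
* `h ≥ 1`, an EULER-TYPE INTEGRAL COMPARISON with continuous integrands on `[0,1]` (no Beta or Gamma function enters):
  `J_m := ∫₀¹ t^{h-1+m}(1-t)^{h-1}dt` obeys `J_{m+1}(2h+m) = J_m(h+m)` (ONE integration by parts, `integral_rpow_succ_mul`), so
  `a_m J_0 = c_m J_m` and `₂F₁(h,h;2h;z)·J_0 ≤ ∫₀¹ t^{h-1}(1-t)^{h-1}(1-zt)^{-h}dt` (partial sums of the binomial series under the integral,
  `chiralBlock_mul_integral_le`); at `z = 4ρ/(1+ρ)²`, `1 - zt = D/(1+ρ)²` with `D = (1-ρ)² + 4ρ(1-t)` and **`4t(1-t) ≤ D ⇔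
  (1-ρ-2(1-t))² ≥ 0`**, so the integrand is `≤ (1+ρ)^{2h}4^{1-h}/(1-ρ)²` (`integrand_le`); and `J_0 ≥ 2δ(¼-δ²)^{h-1} ≥ 4^{1-h}/(e√h)` at
  `δ = 1/(2√h)` (`integral_base_ge`); together **`chiralBlock_le_of_one_le`: `k_{2h}(z) ≤ e√h(4ρ)^h/(1-ρ)²`**;
* uniformly **`chiralBlock_le_sharp`: `k_{2h}(4ρ/(1+ρ)²) ≤ e(1+√h)(4ρ)^h/(1-ρ)²` for all `h ≥ 0`, `ρ ∈ (0,1)`** — with the lower half,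
  the chiral block is `(4ρ)^h` up to a factor polynomial in `h` and `1/(1-ρ)` (the symmetrised-block corollary and the rate are in
  `Control2DOpeRateSharp`).

NOT claimed: the `ρ`-expansion / positivity of all `ρ`-coefficients of `k_{2h}`, Hogervorst–Rychkov's closed form or its constant
`(1-ρ²)^{-1/2}`; Euler's integral REPRESENTATION as an identity with Gamma-function constants (only the comparison `F·J_0 ≤ ∫ …` and an
elementary lower bound on `J_0` are used); complex `z`; anything about a datum, a CFT, `d = 3`, or the record. The papers are CONTEXT,
not cited inputs.

References: D. Pappadopulo, S. Rychkov, J. Espin, R. Rattazzi, Phys. Rev. D 86 (2012) 105043, §5.2 [cite: PappadopuloRychkovEspinRattazzi2012PRD, §5.2];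
M. Hogervorst, S. Rychkov, Phys. Rev. D 87 (2013) 106004, §2 (context) [cite: HogervorstRychkov2013, §2]. Tree: `chiralBlock`,
`chiralBlock_zero` (`Control2DBootstrap`); `chiralCoeff_nonneg` (`Control2DTermwise`); `chiralCoeff_eq_poch` (`Control2DGFFChiral`);
`chiralBlock_nonneg` (`Control2DNonVacuity`); `poch`, `poch_pos`, `poch_succ`, `hasSum_poch_div_factorial_mul_pow` (Literature
`ConformalBootstrap3D`); `hasSum_chiralCoeff_mul_pow`, `chiralBlock_le_rpow_div`, `four_mul_div_sq_mem_Ioo`, `four_mul_div_sq_div_one_sub`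
(`Control2DRhoCoordinate`). Mathlib: `intervalIntegral.integral_mul_deriv_eq_deriv_mul`, `integral_mono_on`, `integral_mono_interval`,
`integral_finsetSum`, `intervalIntegral_pos_of_pos_on`, `Real.hasDerivAt_rpow_const`, `HasDerivAt.rpow_const`,
`Real.one_sub_inv_le_log_of_pos`, `sum_le_hasSum`, `le_of_tendsto'`.
-/
namespace Summit.CriticalPhenomena.Ising3D.Control2D

open Set Filter Topology intervalIntegral
open Literature.MathematicalPhysics.QuantumFieldTheory.ConformalBootstrap3D

/-! ### The Euler-type integrals `J_a = ∫₀¹ t^a (1-t)^{h-1} dt` for `h ≥ 1` -/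

/-- Continuity of `t ↦ t^a (1-t)^b` for `a, b ≥ 0`. [folklore] -/
theorem continuous_rpow_mul_one_sub_rpow {a b : ℝ} (ha : 0 ≤ a) (hb : 0 ≤ b) :
    Continuous fun t : ℝ => t ^ a * (1 - t) ^ b :=
  (Real.continuous_rpow_const ha).mul ((continuous_const.sub continuous_id).rpow_const fun _ => Or.inr hb)

/-- **One integration by parts**: for `a ≥ 0`, `h ≥ 1`,
`∫₀¹ t^{a+1}(1-t)^{h-1} dt = ((a+1)/(a+1+h)) · ∫₀¹ t^a (1-t)^{h-1} dt`
(`∫ t^a(1-t)^h = (h/(a+1)) ∫ t^{a+1}(1-t)^{h-1}` by parts with `u = t^{a+1}/(a+1)`, `v = (1-t)^h`, both `C¹` on `[0,1]` because the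
exponents are `≥ 1`, and `t^a(1-t)^{h-1} - t^{a+1}(1-t)^{h-1} = t^a(1-t)^h`). [folklore] -/
theorem integral_rpow_succ_mul {a h : ℝ} (ha : 0 ≤ a) (hh : 1 ≤ h) :
    ∫ t in (0 : ℝ)..1, t ^ (a + 1) * (1 - t) ^ (h - 1) =
      (a + 1) / (a + 1 + h) * ∫ t in (0 : ℝ)..1, t ^ a * (1 - t) ^ (h - 1) := by
  set A : ℝ := ∫ t in (0 : ℝ)..1, t ^ a * (1 - t) ^ (h - 1) with hA
  set A' : ℝ := ∫ t in (0 : ℝ)..1, t ^ (a + 1) * (1 - t) ^ (h - 1) with hA'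
  set K : ℝ := ∫ t in (0 : ℝ)..1, t ^ a * (1 - t) ^ h with hK
  have ha1 : 0 ≤ a + 1 := by linarith
  have hh0 : 0 ≤ h - 1 := by linarith
  have hcA := continuous_rpow_mul_one_sub_rpow ha hh0
  have hcA' := continuous_rpow_mul_one_sub_rpow ha1 hh0
  have h1 : A - A' = K := by
    rw [hA, hA', ← intervalIntegral.integral_sub (hcA.intervalIntegrable 0 1) (hcA'.intervalIntegrable 0 1), hK]
    refine intervalIntegral.integral_congr fun t ht => ?_
    rw [uIcc_of_le zero_le_one] at ht
    have ht0 : 0 ≤ t := ht.1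
    have ht1 : 0 ≤ 1 - t := by linarith [ht.2]
    rw [Real.rpow_add' ht0 (by linarith : a + 1 ≠ 0), Real.rpow_one,
      show (1 - t) ^ h = (1 - t) ^ (h - 1 + 1) by ring_nf, Real.rpow_add' ht1 (by linarith : h - 1 + 1 ≠ 0), Real.rpow_one]
    ring
  have hu : ∀ t ∈ uIcc (0 : ℝ) 1, HasDerivAt (fun x : ℝ => x ^ (a + 1) / (a + 1)) (t ^ a) t := by
    intro t _
    have h0 := (Real.hasDerivAt_rpow_const (x := t) (p := a + 1) (Or.inr (by linarith))).div_const (a + 1)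
    have : (a + 1) * t ^ (a + 1 - 1) / (a + 1) = t ^ a := by
      rw [show a + 1 - 1 = a by ring]; field_simp
    rwa [this] at h0
  have hv : ∀ t ∈ uIcc (0 : ℝ) 1, HasDerivAt (fun x : ℝ => (1 - x) ^ h) (-(h * (1 - t) ^ (h - 1))) t := by
    intro t _
    have h0 := ((hasDerivAt_id t).const_sub 1).rpow_const (p := h) (Or.inr hh)
    have : (-1 : ℝ) * h * (1 - t) ^ (h - 1) = -(h * (1 - t) ^ (h - 1)) := by ring
    simpa [this] using h0
  have hu' : IntervalIntegrable (fun t : ℝ => t ^ a) MeasureTheory.volume 0 1 :=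
    (Real.continuous_rpow_const ha).intervalIntegrable 0 1
  have hv' : IntervalIntegrable (fun t : ℝ => -(h * (1 - t) ^ (h - 1))) MeasureTheory.volume 0 1 :=
    ((continuous_const.mul ((continuous_const.sub continuous_id).rpow_const fun _ => Or.inr hh0)).neg).intervalIntegrable 0 1
  have hparts := intervalIntegral.integral_mul_deriv_eq_deriv_mul hu hv hu' hv'
  have hlhs : (∫ t in (0 : ℝ)..1, t ^ (a + 1) / (a + 1) * -(h * (1 - t) ^ (h - 1))) = -(h / (a + 1)) * A' := by
    rw [hA', ← intervalIntegral.integral_const_mul]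
    refine intervalIntegral.integral_congr fun t _ => ?_
    ring
  have hb1 : (1 : ℝ) ^ (a + 1) / (a + 1) * (1 - 1) ^ h = 0 := by
    rw [sub_self, Real.zero_rpow (by linarith : h ≠ 0)]; ring
  have hb0 : (0 : ℝ) ^ (a + 1) / (a + 1) * (1 - 0) ^ h = 0 := by
    rw [Real.zero_rpow (by linarith : a + 1 ≠ 0)]; ring
  rw [hlhs, hb1, hb0] at hparts
  have hden : a + 1 + h ≠ 0 := by linarith
  have hAeq : A = A' + h / (a + 1) * A' := by linarith
  rw [hAeq]; field_simp

/-- **`J_m = ((h)_m/(2h)_m) · J_0`**: `∫₀¹ t^{h-1+m}(1-t)^{h-1} dt = ((h)_m/(2h)_m) ∫₀¹ t^{h-1}(1-t)^{h-1} dt` for `h ≥ 1` (induction on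
`integral_rpow_succ_mul`). [folklore] -/
theorem integral_rpow_add_nat_mul {h : ℝ} (hh : 1 ≤ h) (m : ℕ) :
    ∫ t in (0 : ℝ)..1, t ^ (h - 1 + m) * (1 - t) ^ (h - 1) =
      poch h m / poch (2 * h) m * ∫ t in (0 : ℝ)..1, t ^ (h - 1) * (1 - t) ^ (h - 1) := by
  induction m with
  | zero => simp
  | succ m ih =>
    have hstep := integral_rpow_succ_mul (a := h - 1 + m) (by have := (Nat.cast_nonneg m : (0 : ℝ) ≤ m); linarith) hh
    rw [show h - 1 + ((m + 1 : ℕ) : ℝ) = h - 1 + m + 1 by push_cast; ring, hstep, ih, poch_succ, poch_succ]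
    have h1 : poch (2 * h) m ≠ 0 := poch_ne_zero (by linarith) m
    have h2 : 2 * h + m ≠ 0 := by have := (Nat.cast_nonneg m : (0 : ℝ) ≤ m); linarith
    have h3 : h - 1 + m + 1 + h = 2 * h + m := by ring
    rw [h3]
    field_simp
    ring

/-- The base integral `J_0 = ∫₀¹ (t(1-t))^{h-1} dt` is positive for `h ≥ 1`. [folklore] -/
theorem integral_base_pos {h : ℝ} (hh : 1 ≤ h) : 0 < ∫ t in (0 : ℝ)..1, t ^ (h - 1) * (1 - t) ^ (h - 1) := by
  have hh0 : 0 ≤ h - 1 := by linarith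
  refine intervalIntegral.intervalIntegral_pos_of_pos_on ((continuous_rpow_mul_one_sub_rpow hh0 hh0).intervalIntegrable 0 1)
    (fun t ht => mul_pos (Real.rpow_pos_of_pos ht.1 _) (Real.rpow_pos_of_pos (by linarith [ht.2]) _)) zero_lt_one

/-- `(1 - 1/h)^{h-1} ≥ e^{-1}` for `h ≥ 1` (`log(1-x) ≥ -x/(1-x)`; at `h = 1` the left side is `0^0 = 1`). [folklore] -/
theorem exp_neg_one_le_rpow {h : ℝ} (hh : 1 ≤ h) : Real.exp (-1) ≤ (1 - 1 / h) ^ (h - 1) := by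
  rcases hh.lt_or_eq with hgt | heq
  · have hx0 : 0 < 1 - 1 / h := by have : 1 / h < 1 := (by rw [div_lt_one (by linarith)]; linarith); linarith
    rw [Real.rpow_def_of_pos hx0, Real.exp_le_exp]
    have hlog := Real.one_sub_inv_le_log_of_pos hx0
    have hinv : (1 - 1 / h)⁻¹ = h / (h - 1) := by have : (h - 1) ≠ 0 := (by linarith); field_simp
    rw [hinv] at hlog
    have hh1 : 0 < h - 1 := by linarith
    have : (1 - h / (h - 1)) * (h - 1) = -1 := by field_simp; ring
    nlinarith [mul_le_mul_of_nonneg_right hlog hh1.le]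
  · subst heq; norm_num

/-- **Lower bound on the base integral**: `J_0 ≥ 4^{1-h}/(e√h)` for `h ≥ 1` — on `[½-δ, ½+δ]` with `δ = 1/(2√h)` the integrand is
`≥ (¼ - δ²)^{h-1} = 4^{1-h}(1-1/h)^{h-1} ≥ 4^{1-h} e^{-1}`, and the interval has length `1/√h`. (No Beta or Gamma function is used.)
[folklore] -/
theorem integral_base_ge {h : ℝ} (hh : 1 ≤ h) :
    (4 : ℝ) ^ (1 - h) / (Real.exp 1 * Real.sqrt h) ≤ ∫ t in (0 : ℝ)..1, t ^ (h - 1) * (1 - t) ^ (h - 1) := by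
  have hh0 : 0 ≤ h - 1 := by linarith
  have hhpos : 0 < h := by linarith
  have hsq : 0 < Real.sqrt h := Real.sqrt_pos.mpr hhpos
  have hsq1 : 1 ≤ Real.sqrt h := by rw [← Real.sqrt_one]; exact Real.sqrt_le_sqrt hh
  set δ : ℝ := 1 / (2 * Real.sqrt h) with hδ
  have hδ0 : 0 < δ := by positivity
  have hδ2 : δ ≤ 1 / 2 := by rw [hδ, div_le_div_iff₀ (by positivity) (by norm_num)]; linarith
  have hδsq : δ ^ 2 = 1 / (4 * h) := by
    rw [hδ, div_pow, mul_pow, Real.sq_sqrt hhpos.le]; norm_num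
  have hcont := continuous_rpow_mul_one_sub_rpow hh0 hh0
  have hc0 : 0 ≤ 1 / 4 - δ ^ 2 := by nlinarith
  have hptw : ∀ t ∈ Icc (1 / 2 - δ) (1 / 2 + δ), (1 / 4 - δ ^ 2) ^ (h - 1) ≤ t ^ (h - 1) * (1 - t) ^ (h - 1) := by
    intro t ht
    have ht0 : 0 ≤ t := by linarith [ht.1]
    have ht1 : 0 ≤ 1 - t := by linarith [ht.2]
    rw [← Real.mul_rpow ht0 ht1]
    refine Real.rpow_le_rpow hc0 ?_ hh0
    nlinarith [ht.1, ht.2, sq_nonneg (t - 1 / 2)]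
  have hsub : (∫ t in (1 / 2 - δ)..(1 / 2 + δ), (1 / 4 - δ ^ 2) ^ (h - 1)) ≤
      ∫ t in (1 / 2 - δ)..(1 / 2 + δ), t ^ (h - 1) * (1 - t) ^ (h - 1) :=
    intervalIntegral.integral_mono_on (by linarith) (intervalIntegrable_const) (hcont.intervalIntegrable _ _) hptw
  have hmono : (∫ t in (1 / 2 - δ)..(1 / 2 + δ), t ^ (h - 1) * (1 - t) ^ (h - 1)) ≤
      ∫ t in (0 : ℝ)..1, t ^ (h - 1) * (1 - t) ^ (h - 1) := by
    refine intervalIntegral.integral_mono_interval (by linarith) (by linarith) (by linarith) ?_ (hcont.intervalIntegrable 0 1)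
    rw [Filter.EventuallyLE, MeasureTheory.ae_restrict_iff' measurableSet_Ioc]
    exact Filter.Eventually.of_forall fun t ht =>
      mul_nonneg (Real.rpow_nonneg ht.1.le _) (Real.rpow_nonneg (by linarith [ht.2]) _)
  rw [intervalIntegral.integral_const, smul_eq_mul] at hsub
  have hlen : 1 / 2 + δ - (1 / 2 - δ) = 1 / Real.sqrt h := by rw [hδ]; field_simp; ring
  rw [hlen] at hsub
  have hq : 1 / 4 - δ ^ 2 = 1 / 4 * (1 - 1 / h) := by rw [hδsq]; field_simp
  have h4 : (1 / 4 : ℝ) ^ (h - 1) = (4 : ℝ) ^ (1 - h) := by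
    rw [one_div, Real.inv_rpow (by norm_num), ← Real.rpow_neg (by norm_num), neg_sub]
  have h1h : 0 ≤ 1 - 1 / h := by have : 1 / h ≤ 1 := (by rw [div_le_one hhpos]; exact hh); linarith
  have hval : (4 : ℝ) ^ (1 - h) * Real.exp (-1) ≤ (1 / 4 - δ ^ 2) ^ (h - 1) := by
    rw [hq, Real.mul_rpow (by norm_num) h1h, h4]
    exact mul_le_mul_of_nonneg_left (exp_neg_one_le_rpow hh) (Real.rpow_nonneg (by norm_num) _)
  have h4pos : 0 < (4 : ℝ) ^ (1 - h) := Real.rpow_pos_of_pos (by norm_num) _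
  calc (4 : ℝ) ^ (1 - h) / (Real.exp 1 * Real.sqrt h)
      = 1 / Real.sqrt h * ((4 : ℝ) ^ (1 - h) * Real.exp (-1)) := by rw [Real.exp_neg]; field_simp
    _ ≤ 1 / Real.sqrt h * (1 / 4 - δ ^ 2) ^ (h - 1) := mul_le_mul_of_nonneg_left hval (by positivity)
    _ ≤ _ := hsub.trans hmono

/-! ### The series side: `₂F₁(h,h;2h;z) · J_0 ≤ ∫₀¹ (t(1-t))^{h-1} (1-zt)^{-h} dt` -/

/-- `t^{h-1+m} = t^{h-1} t^m` on `[0, ∞)` (also at `t = 0`). [folklore] -/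
theorem rpow_sub_one_add_nat {h : ℝ} (hh : 1 ≤ h) {t : ℝ} (ht : 0 ≤ t) (m : ℕ) :
    t ^ (h - 1 + m) = t ^ (h - 1) * t ^ m := by
  rcases ht.lt_or_eq with hpos | hzero
  · rw [Real.rpow_add_natCast hpos.ne']
  · subst hzero
    rcases Nat.eq_zero_or_pos m with hm | hm
    · subst hm; simp
    · rw [zero_pow hm.ne', mul_zero, Real.zero_rpow]
      have := (Nat.cast_pos.mpr hm : (0 : ℝ) < m); linarith

/-- **The integral comparison** (`h ≥ 1`, `0 < z < 1`): `(k_{2h}(z) z^{-h}) · J_0 ≤ ∫₀¹ t^{h-1}(1-t)^{h-1} (1-zt)^{-h} dt` — for every `N`,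
`Σ_{m<N} a_m z^m J_0 = ∫₀¹ (Σ_{m<N} c_m (zt)^m) t^{h-1}(1-t)^{h-1} dt` (`a_m J_0 = c_m J_m`), the bracket is a partial sum of the binomial
series `(1-zt)^{-h}` with non-negative terms, and `N → ∞`. [folklore] -/
theorem chiralBlock_mul_integral_le {h z : ℝ} (hh : 1 ≤ h) (hz0 : 0 < z) (hz1 : z < 1) :
    chiralBlock h z * (z ^ h)⁻¹ * (∫ t in (0 : ℝ)..1, t ^ (h - 1) * (1 - t) ^ (h - 1)) ≤
      ∫ t in (0 : ℝ)..1, t ^ (h - 1) * (1 - t) ^ (h - 1) * (1 / (1 - z * t) ^ h) := by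
  have hh0 : 0 ≤ h - 1 := by linarith
  have hhpos : 0 < h := by linarith
  set J0 : ℝ := ∫ t in (0 : ℝ)..1, t ^ (h - 1) * (1 - t) ^ (h - 1) with hJ0
  set I : ℝ := ∫ t in (0 : ℝ)..1, t ^ (h - 1) * (1 - t) ^ (h - 1) * (1 / (1 - z * t) ^ h) with hI
  have hcw := continuous_rpow_mul_one_sub_rpow hh0 hh0
  have hterm : ∀ m : ℕ, Continuous fun t : ℝ => poch h m / (m.factorial : ℝ) * z ^ m * (t ^ (h - 1 + m) * (1 - t) ^ (h - 1)) :=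
    fun m => continuous_const.mul (continuous_rpow_mul_one_sub_rpow (by have := (Nat.cast_nonneg m : (0 : ℝ) ≤ m); linarith) hh0)
  have hIint : IntervalIntegrable (fun t : ℝ => t ^ (h - 1) * (1 - t) ^ (h - 1) * (1 / (1 - z * t) ^ h))
      MeasureTheory.volume 0 1 := by
    refine ContinuousOn.intervalIntegrable ?_
    rw [uIcc_of_le zero_le_one]
    refine hcw.continuousOn.mul (ContinuousOn.div continuousOn_const ?_ fun t ht => ?_)
    · exact ((continuous_const.sub (continuous_const.mul continuous_id)).continuousOn).rpow_const
        fun t _ => Or.inr hhpos.le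
    · have : 0 < 1 - z * t := by nlinarith [ht.2, hz1, hz0]
      exact (Real.rpow_pos_of_pos this h).ne'
  have hpartial : ∀ N : ℕ, (∑ m ∈ Finset.range N, chiralCoeff h m * z ^ m) * J0 ≤ I := by
    intro N
    have hstep : ∀ m : ℕ, chiralCoeff h m * z ^ m * J0 =
        ∫ t in (0 : ℝ)..1, poch h m / (m.factorial : ℝ) * z ^ m * (t ^ (h - 1 + m) * (1 - t) ^ (h - 1)) := by
      intro m
      rw [intervalIntegral.integral_const_mul, integral_rpow_add_nat_mul hh m, ← hJ0, chiralCoeff_eq_poch]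
      have h1 : poch (2 * h) m ≠ 0 := poch_ne_zero (by linarith) m
      have h2 : (m.factorial : ℝ) ≠ 0 := by positivity
      field_simp
    calc (∑ m ∈ Finset.range N, chiralCoeff h m * z ^ m) * J0
        = ∑ m ∈ Finset.range N, chiralCoeff h m * z ^ m * J0 := Finset.sum_mul _ _ _
      _ = ∑ m ∈ Finset.range N, ∫ t in (0 : ℝ)..1,
            poch h m / (m.factorial : ℝ) * z ^ m * (t ^ (h - 1 + m) * (1 - t) ^ (h - 1)) := Finset.sum_congr rfl fun m _ => hstep m
      _ = ∫ t in (0 : ℝ)..1, ∑ m ∈ Finset.range N,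
            poch h m / (m.factorial : ℝ) * z ^ m * (t ^ (h - 1 + m) * (1 - t) ^ (h - 1)) :=
          (intervalIntegral.integral_finsetSum fun m _ => (hterm m).intervalIntegrable 0 1).symm
      _ ≤ I := by
          refine intervalIntegral.integral_mono_on zero_le_one
            ((continuous_finsetSum _ fun m _ => hterm m).intervalIntegrable 0 1) hIint fun t ht => ?_
          have ht0 : 0 ≤ t := ht.1
          have ht1 : 0 ≤ 1 - t := by linarith [ht.2]
          have hzt : |z * t| < 1 := by
            rw [abs_of_nonneg (mul_nonneg hz0.le ht0)]; nlinarith [ht.2]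
          have hw0 : 0 ≤ t ^ (h - 1) * (1 - t) ^ (h - 1) := mul_nonneg (Real.rpow_nonneg ht0 _) (Real.rpow_nonneg ht1 _)
          -- rewrite the finite sum as `w(t) · Σ c_m (zt)^m`
          have hrew : ∑ m ∈ Finset.range N, poch h m / (m.factorial : ℝ) * z ^ m * (t ^ (h - 1 + m) * (1 - t) ^ (h - 1)) =
              t ^ (h - 1) * (1 - t) ^ (h - 1) * ∑ m ∈ Finset.range N, poch h m / (m.factorial : ℝ) * (z * t) ^ m := by
            rw [Finset.mul_sum]
            refine Finset.sum_congr rfl fun m _ => ?_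
            rw [rpow_sub_one_add_nat hh ht0 m, mul_pow]; ring
          rw [hrew]
          refine mul_le_mul_of_nonneg_left ?_ hw0
          exact sum_le_hasSum (Finset.range N)
            (fun m _ => mul_nonneg (div_nonneg (poch_pos hhpos m).le (by positivity)) (pow_nonneg (mul_nonneg hz0.le ht0) m))
            (hasSum_poch_div_factorial_mul_pow h hzt)
  have hlim := ((hasSum_chiralCoeff_mul_pow h hz0 hz1).tendsto_sum_nat).mul_const J0
  exact le_of_tendsto' hlim hpartial

/-! ### The pointwise bound at `z = 4ρ/(1+ρ)²` and the conclusion for `h ≥ 1` -/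

/-- **`4t(1-t) ≤ (1-ρ)² + 4ρ(1-t)`** — the square `(1-ρ-2(1-t))² ≥ 0`. [folklore] -/
theorem four_mul_mul_one_sub_le (ρ t : ℝ) : 4 * t * (1 - t) ≤ (1 - ρ) ^ 2 + 4 * ρ * (1 - t) := by
  nlinarith [sq_nonneg (1 - ρ - 2 * (1 - t))]

/-- **The pointwise bound** (`h ≥ 1`, `ρ ∈ (0,1)`, `t ∈ [0,1]`, `z = 4ρ/(1+ρ)²`):
`t^{h-1}(1-t)^{h-1}(1-zt)^{-h} ≤ (1+ρ)^{2h} · 4^{1-h}/(1-ρ)²` — `1 - zt = D/(1+ρ)²` with `D = (1-ρ)² + 4ρ(1-t) ≥ (1-ρ)²`, and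
`(t(1-t))^{h-1} ≤ (D/4)^{h-1}`. [folklore] -/
theorem integrand_le {h ρ t : ℝ} (hh : 1 ≤ h) (hρ : ρ ∈ Ioo (0 : ℝ) 1) (ht : t ∈ Icc (0 : ℝ) 1) :
    t ^ (h - 1) * (1 - t) ^ (h - 1) * (1 / (1 - 4 * ρ / (1 + ρ) ^ 2 * t) ^ h) ≤
      (1 + ρ) ^ (2 * h) * (4 : ℝ) ^ (1 - h) / (1 - ρ) ^ 2 := by
  have hh0 : 0 ≤ h - 1 := by linarith
  have hP : 0 < 1 + ρ := by linarith [hρ.1]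
  have hQ : 0 < 1 - ρ := by linarith [hρ.2]
  have ht0 : 0 ≤ t := ht.1
  have ht1 : 0 ≤ 1 - t := by linarith [ht.2]
  set D : ℝ := (1 - ρ) ^ 2 + 4 * ρ * (1 - t) with hD
  have hDge : (1 - ρ) ^ 2 ≤ D := by rw [hD]; nlinarith [hρ.1]
  have hDpos : 0 < D := lt_of_lt_of_le (by positivity) hDge
  have hzt : 1 - 4 * ρ / (1 + ρ) ^ 2 * t = D / (1 + ρ) ^ 2 := by
    rw [hD]; field_simp; ring
  have hpow : (1 - 4 * ρ / (1 + ρ) ^ 2 * t) ^ h = D ^ h / (1 + ρ) ^ (2 * h) := by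
    rw [hzt, Real.div_rpow hDpos.le (pow_nonneg hP.le 2), ← Real.rpow_natCast (1 + ρ) 2, ← Real.rpow_mul hP.le]
    norm_num
  have hw : t ^ (h - 1) * (1 - t) ^ (h - 1) ≤ D ^ (h - 1) * (4 : ℝ) ^ (1 - h) := by
    rw [← Real.mul_rpow ht0 ht1]
    have h1 : t * (1 - t) ≤ D / 4 := by have := four_mul_mul_one_sub_le ρ t; rw [hD]; linarith
    have h2 := Real.rpow_le_rpow (mul_nonneg ht0 ht1) h1 hh0
    rw [Real.div_rpow hDpos.le (by norm_num), div_eq_mul_inv, ← Real.rpow_neg (by norm_num), neg_sub] at h2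
    exact h2
  have hDh : 0 < D ^ h := Real.rpow_pos_of_pos hDpos h
  have hDh1 : D ^ (h - 1) = D ^ h / D := Real.rpow_sub_one hDpos.ne' h
  have hP2h : 0 < (1 + ρ) ^ (2 * h) := Real.rpow_pos_of_pos hP _
  have h4 : 0 < (4 : ℝ) ^ (1 - h) := Real.rpow_pos_of_pos (by norm_num) _
  rw [hpow, one_div, inv_div]
  calc t ^ (h - 1) * (1 - t) ^ (h - 1) * ((1 + ρ) ^ (2 * h) / D ^ h)
      ≤ D ^ (h - 1) * (4 : ℝ) ^ (1 - h) * ((1 + ρ) ^ (2 * h) / D ^ h) :=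
        mul_le_mul_of_nonneg_right hw (div_pos hP2h hDh).le
    _ = (1 + ρ) ^ (2 * h) * (4 : ℝ) ^ (1 - h) / D := by rw [hDh1]; field_simp
    _ ≤ (1 + ρ) ^ (2 * h) * (4 : ℝ) ^ (1 - h) / (1 - ρ) ^ 2 :=
        div_le_div_of_nonneg_left (mul_pos hP2h h4).le (by positivity) hDge

/-- **`₂F₁(h,h;2h;z(ρ)) ≤ (1+ρ)^{2h} · e√h/(1-ρ)²` for `h ≥ 1`**, in the form `k_{2h}(z) z^{-h} ≤ …` (the integral comparison, the pointwise
bound integrated over `[0,1]`, and `J_0 ≥ 4^{1-h}/(e√h)`). [folklore] -/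
theorem chiralBlock_mul_inv_rpow_le_sharp {h ρ : ℝ} (hh : 1 ≤ h) (hρ : ρ ∈ Ioo (0 : ℝ) 1) :
    chiralBlock h (4 * ρ / (1 + ρ) ^ 2) * ((4 * ρ / (1 + ρ) ^ 2) ^ h)⁻¹ ≤
      (1 + ρ) ^ (2 * h) * (Real.exp 1 * Real.sqrt h) / (1 - ρ) ^ 2 := by
  have hz := four_mul_div_sq_mem_Ioo hρ
  have hh0 : 0 ≤ h - 1 := by linarith
  have hhpos : 0 < h := by linarith
  have hQ : 0 < 1 - ρ := by linarith [hρ.2]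
  set z : ℝ := 4 * ρ / (1 + ρ) ^ 2 with hzdef
  set J0 : ℝ := ∫ t in (0 : ℝ)..1, t ^ (h - 1) * (1 - t) ^ (h - 1) with hJ0
  set C : ℝ := (1 + ρ) ^ (2 * h) * (4 : ℝ) ^ (1 - h) / (1 - ρ) ^ 2 with hC
  have hJ0pos : 0 < J0 := integral_base_pos hh
  have hJ0ge := integral_base_ge hh
  have h1 := chiralBlock_mul_integral_le hh hz.1 hz.2
  have h2 : (∫ t in (0 : ℝ)..1, t ^ (h - 1) * (1 - t) ^ (h - 1) * (1 / (1 - z * t) ^ h)) ≤ ∫ t in (0 : ℝ)..1, C := by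
    refine intervalIntegral.integral_mono_on zero_le_one ?_ intervalIntegrable_const fun t ht => integrand_le hh hρ ht
    refine ContinuousOn.intervalIntegrable ?_
    rw [uIcc_of_le zero_le_one]
    refine (continuous_rpow_mul_one_sub_rpow hh0 hh0).continuousOn.mul (ContinuousOn.div continuousOn_const ?_ fun t ht => ?_)
    · exact ((continuous_const.sub (continuous_const.mul continuous_id)).continuousOn).rpow_const fun t _ => Or.inr hhpos.le
    · have : 0 < 1 - z * t := by nlinarith [ht.2, hz.2, hz.1]
      exact (Real.rpow_pos_of_pos this h).ne'
  rw [intervalIntegral.integral_const, sub_zero, one_smul] at h2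
  set A : ℝ := chiralBlock h z * (z ^ h)⁻¹ with hA
  have hA0 : 0 ≤ A := mul_nonneg (chiralBlock_nonneg hhpos.le hz) (inv_nonneg.mpr (Real.rpow_nonneg hz.1.le _))
  have hAJ : A * J0 ≤ C := h1.trans h2
  have hEs : 0 < Real.exp 1 * Real.sqrt h := mul_pos (Real.exp_pos 1) (Real.sqrt_pos.mpr hhpos)
  have h4 : 0 < (4 : ℝ) ^ (1 - h) := Real.rpow_pos_of_pos (by norm_num) _
  have hP2h : 0 < (1 + ρ) ^ (2 * h) := Real.rpow_pos_of_pos (by linarith [hρ.1]) _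
  have hJ : (4 : ℝ) ^ (1 - h) ≤ Real.exp 1 * Real.sqrt h * J0 := by
    have := (div_le_iff₀ hEs).mp hJ0ge; linarith
  calc A = A * J0 / J0 := by field_simp
    _ ≤ C / J0 := div_le_div_of_nonneg_right hAJ hJ0pos.le
    _ = (1 + ρ) ^ (2 * h) / (1 - ρ) ^ 2 * ((4 : ℝ) ^ (1 - h) / J0) := by rw [hC]; field_simp
    _ ≤ (1 + ρ) ^ (2 * h) / (1 - ρ) ^ 2 * (Real.exp 1 * Real.sqrt h) :=
        mul_le_mul_of_nonneg_left ((div_le_iff₀ hJ0pos).mpr hJ) (div_pos hP2h (by positivity)).le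
    _ = _ := by field_simp

/-- **The upper half for `h ≥ 1`**: `k_{2h}(4ρ/(1+ρ)²) ≤ e·√h·(4ρ)^h/(1-ρ)²` (`z^h (1+ρ)^{2h} = (4ρ)^h`). [folklore] -/
theorem chiralBlock_le_of_one_le {h ρ : ℝ} (hh : 1 ≤ h) (hρ : ρ ∈ Ioo (0 : ℝ) 1) :
    chiralBlock h (4 * ρ / (1 + ρ) ^ 2) ≤ Real.exp 1 * Real.sqrt h * (4 * ρ) ^ h / (1 - ρ) ^ 2 := by
  have hz := four_mul_div_sq_mem_Ioo hρ
  have hP : 0 < 1 + ρ := by linarith [hρ.1]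
  have h4ρ : 0 < 4 * ρ := by linarith [hρ.1]
  have hzh : 0 < (4 * ρ / (1 + ρ) ^ 2) ^ h := Real.rpow_pos_of_pos hz.1 h
  have h1 := mul_le_mul_of_nonneg_right (chiralBlock_mul_inv_rpow_le_sharp hh hρ) hzh.le
  rw [mul_assoc, inv_mul_cancel₀ hzh.ne', mul_one] at h1
  refine h1.trans (le_of_eq ?_)
  rw [Real.div_rpow h4ρ.le (pow_nonneg hP.le 2), ← Real.rpow_natCast (1 + ρ) 2, ← Real.rpow_mul hP.le]
  push_cast
  have hP2h : (1 + ρ) ^ (2 * h) ≠ 0 := (Real.rpow_pos_of_pos hP _).ne'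
  field_simp

/-- **The upper half for `0 ≤ h ≤ 1`**, from the landed uniform envelope: `k_{2h}(4ρ/(1+ρ)²) ≤ (z/(1-z))^h = (4ρ)^h (1-ρ)^{-2h} ≤
(4ρ)^h/(1-ρ)²`. [folklore] -/
theorem chiralBlock_le_of_le_one {h ρ : ℝ} (hh0 : 0 ≤ h) (hh1 : h ≤ 1) (hρ : ρ ∈ Ioo (0 : ℝ) 1) :
    chiralBlock h (4 * ρ / (1 + ρ) ^ 2) ≤ (4 * ρ) ^ h / (1 - ρ) ^ 2 := by
  have hz := four_mul_div_sq_mem_Ioo hρ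
  have hQ : 0 < 1 - ρ := by linarith [hρ.2]
  have h4ρ : 0 < 4 * ρ := by linarith [hρ.1]
  have h1 := chiralBlock_le_rpow_div hh0 hz.1 hz.2
  rw [four_mul_div_sq_div_one_sub hρ.1.le hρ.2, Real.div_rpow h4ρ.le (pow_nonneg hQ.le 2)] at h1
  refine h1.trans (div_le_div_of_nonneg_left (Real.rpow_nonneg h4ρ.le _) (by positivity) ?_)
  have hq1 : (1 - ρ) ^ 2 ≤ 1 := by nlinarith [hρ.1, hρ.2]
  calc (1 - ρ) ^ 2 = ((1 - ρ) ^ 2) ^ (1 : ℝ) := (Real.rpow_one _).symm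
    _ ≤ ((1 - ρ) ^ 2) ^ h := Real.rpow_le_rpow_of_exponent_ge (by positivity) hq1 hh1

/-- **The upper half, uniformly in `h ≥ 0`**: `k_{2h}(4ρ/(1+ρ)²) ≤ e·(1+√h)·(4ρ)^h/(1-ρ)²` for every `h ≥ 0`, `ρ ∈ (0,1)`. With
`Control2DRhoCoordinate.rpow_four_mul_le_chiralBlock`: `(4ρ)^h ≤ k_{2h}(z) ≤ e(1+√h)(4ρ)^h/(1-ρ)²` — the chiral block is `(4ρ)^h` up to a
factor polynomial in `h` and `1/(1-ρ)`, with no `ρ`-expansion. [folklore] -/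
theorem chiralBlock_le_sharp {h ρ : ℝ} (hh : 0 ≤ h) (hρ : ρ ∈ Ioo (0 : ℝ) 1) :
    chiralBlock h (4 * ρ / (1 + ρ) ^ 2) ≤ Real.exp 1 * (1 + Real.sqrt h) * (4 * ρ) ^ h / (1 - ρ) ^ 2 := by
  have hQ : 0 < 1 - ρ := by linarith [hρ.2]
  have h4ρ : 0 ≤ (4 * ρ) ^ h := Real.rpow_nonneg (by linarith [hρ.1]) _
  have he : 1 ≤ Real.exp 1 := Real.one_le_exp (by norm_num)
  have hs : 0 ≤ Real.sqrt h := Real.sqrt_nonneg h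
  rcases le_or_gt h 1 with hle | hgt
  · refine (chiralBlock_le_of_le_one hh hle hρ).trans (div_le_div_of_nonneg_right ?_ (by positivity))
    nlinarith [mul_nonneg (Real.exp_pos 1).le hs, mul_nonneg (sub_nonneg.mpr he) h4ρ]
  · refine (chiralBlock_le_of_one_le hgt.le hρ).trans (div_le_div_of_nonneg_right ?_ (by positivity))
    nlinarith [mul_nonneg (Real.exp_pos 1).le h4ρ]

end Summit.CriticalPhenomena.Ising3D.Control2D
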